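import Literature.NumberTheory.Automorphic.QuaternionDefiniteNorm
import Literature.NumberTheory.Automorphic.QuaternionAlgebraAdelicInvolutionProofs
import Literature.NumberTheory.EllipticCurves.GrossPointsThetaElement
import Literature.NumberTheory.EllipticCurves.HeegnerPoints
import Mathlib.FieldTheory.PrimitiveElement
import Mathlib.NumberTheory.NumberField.InfinitePlace.TotallyRealComplex
import HarnessLib

/-!
# A number field embedded in a definite quaternion algebra over `ℚ` is `ℚ` or imaginary quadratic;
# hence a tower of Gross points forces `[K:ℚ] = 1` or `K` imaginary quadratic

Route-independent `Theorems` file (cell `b2b-bsdres`, seat `b2b-bsdres-x10b`, gen 44), part 9 of the series «tower square root» serving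
crux `DerivedHeightCap` (stmt-BirchSwinnertonDyer-18438, route DefiniteTheta): it pins down how much wider than the line the REGISTERED
stub `stub_towerSqrt` (quantified over every number field `K`) really is — after this file only `K ≅ ℚ` (degenerate tower) and `p = 2`
separate it from the landed `towerSqrt_of_isImaginaryQuadratic` (part 8).
HONEST FRAMING: no curve asserted, no class closed, BSD not proved by any of this.

* §1 `finrank_le_two_of_algHom`: a number field `K` with a `ℚ`-algebra map into a quaternion algebra `D` over `ℚ` has `[K:ℚ] ≤ 2`
  (every element of `D` satisfies `x² = t x − n`, tree `exists_mul_self_eq_of_isQuaternionAlgebra`; primitive element).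
* §2 `isTotallyComplex_of_algHom`: if moreover `D` is totally definite and `[K:ℚ] = 2`, then `K` is totally complex: a real place would
  make the discriminant of a primitive element positive, producing `x ∈ D ∖ ℚ` with `x² = q > 0`, i.e. `nrd(x) = −q < 0`, against
  `reducedNorm_nonneg_of_isTotallyDefinite` (Vignéras III §3: definite ⇔ the norm form is positive).
* §3 `finrank_eq_one_or_isImaginaryQuadratic_of_grossPointTower`: a tower of Gross points on a Brandt setup over `K` exists only for
  `[K:ℚ] = 1` or `K` imaginary quadratic.

## References
* [VignerasLNM800] M.-F. Vignéras, LNM 800, Ch. I §1 (quadratic relation, `nrd`), Ch. III §3 (definite algebras).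
* [BertoliniDarmon1996] §2.1 (Gross points need `K ↪ B` — imaginary quadratic `K`).
-/

noncomputable section

-- D-0017: single-problem summit, the namespace repeats the problem name by design.
set_option linter.dupNamespace false

namespace Summit.BirchSwinnertonDyer.BirchSwinnertonDyer.Theorems.TowerSqrt

open Literature.NumberTheory.Automorphic Literature.NumberTheory.EllipticCurves NumberField Polynomial Module

universe u v

variable {K : Type u} [Field K] [NumberField K] {D : Type v} [Ring D] [Algebra ℚ D]

/-! ### §1 `[K:ℚ] ≤ 2` -/

/-- Pull-back of the quadratic relation: for `f : K →ₐ[ℚ] D` into a quaternion algebra, every `y ∈ K` satisfies `y² = t y − n` with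
`t, n ∈ ℚ`. [cite: VignerasLNM800, Ch. I §1 p. 2] -/
theorem exists_mul_self_eq_of_algHom [IsQuaternionAlgebra ℚ D] (f : K →ₐ[ℚ] D) (y : K) :
    ∃ t n : ℚ, y * y = algebraMap ℚ K t * y - algebraMap ℚ K n := by
  haveI : Nontrivial D := by
    have h4 := IsQuaternionAlgebra.finrank_eq_four (K := ℚ) (D := D)
    exact Module.nontrivial_of_finrank_pos (R := ℚ) (by omega)
  obtain ⟨t, n, h, -⟩ := exists_mul_self_eq_of_isQuaternionAlgebra (K := ℚ) (f y)
  refine ⟨t, n, f.toRingHom.injective ?_⟩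
  simp only [AlgHom.toRingHom_eq_coe, RingHom.coe_coe, map_mul, map_sub, AlgHom.commutes]
  exact h

/-- **`[K:ℚ] ≤ 2`** for a number field `K` with a `ℚ`-algebra map into a quaternion algebra over `ℚ`: a primitive element satisfies a
quadratic equation over `ℚ`. [cite: VignerasLNM800, Ch. I §1 p. 2] -/
theorem finrank_le_two_of_algHom [IsQuaternionAlgebra ℚ D] (f : K →ₐ[ℚ] D) : finrank ℚ K ≤ 2 := by
  obtain ⟨α, hα⟩ := Field.exists_primitive_element ℚ K
  rw [← (Field.primitive_element_iff_minpoly_natDegree_eq ℚ α).mp hα]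
  obtain ⟨t, n, h⟩ := exists_mul_self_eq_of_algHom f α
  -- α is a root of P = X² − tX + n
  set P : ℚ[X] := X ^ 2 - C t * X + C n with hP
  have hroot : aeval α P = 0 := by
    simp only [hP, map_add, map_sub, map_mul, map_pow, aeval_X, aeval_C]
    rw [sq, h]; ring
  have hmonic : P.Monic := by
    have h1 : (X ^ 2 : ℚ[X]).Monic := monic_X_pow 2
    have hdeg : (C t * X - C n).degree < (X ^ 2 : ℚ[X]).degree := by
      rw [degree_X_pow]
      refine (degree_sub_le _ _).trans_lt (max_lt ?_ ?_)
      · exact (degree_C_mul_X_le t).trans_lt (by exact_mod_cast Nat.lt_succ_self 1)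
      · exact (degree_C_le).trans_lt (by exact_mod_cast Nat.succ_pos 1)
    have : P = X ^ 2 - (C t * X - C n) := by rw [hP]; ring
    rw [this]
    exact h1.sub_of_left hdeg
  have hPdeg : P.natDegree ≤ 2 := by
    rw [hP]; compute_degree!
  exact (natDegree_le_of_dvd (minpoly.dvd ℚ α hroot) hmonic.ne_zero).trans hPdeg

/-! ### §2 Totally definite ⇒ `K` totally complex (when `[K:ℚ] = 2`) -/

/-- **A quadratic field inside a totally definite quaternion algebra over `ℚ` is imaginary.** If `[K:ℚ] = 2`, `f : K →ₐ[ℚ] D` with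
`D` totally definite, then `K` has no real place: for a primitive `α` with `α² + bα + c = 0`, a real place gives `b² − 4c > 0`, and
`x = f(α + b/2)` satisfies `x² = (b² − 4c)/4 =: q > 0`, `x ∉ ℚ`, so `trd(x) = 0` and `nrd(x) = −q < 0`, contradicting `nrd ≥ 0`.
[cite: VignerasLNM800, Ch. III §3] -/
theorem isTotallyComplex_of_algHom [IsQuaternionAlgebra ℚ D] (hdef : IsTotallyDefinite ℚ D) (f : K →ₐ[ℚ] D)
    (h2 : finrank ℚ K = 2) : NumberField.IsTotallyComplex K := by
  haveI : Nontrivial D := by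
    have h4 := IsQuaternionAlgebra.finrank_eq_four (K := ℚ) (D := D)
    exact Module.nontrivial_of_finrank_pos (R := ℚ) (by omega)
  have hfinj : Function.Injective f := f.toRingHom.injective
  refine ⟨fun w => ?_⟩
  by_contra hw
  rw [← InfinitePlace.not_isReal_iff_isComplex, not_not] at hw
  set σ : K →+* ℝ := InfinitePlace.embedding_of_isReal hw with hσ
  -- a primitive element and its (monic, quadratic) minimal polynomial
  obtain ⟨α, hα⟩ := Field.exists_primitive_element ℚ K
  have hdeg : (minpoly ℚ α).natDegree = 2 := by
    rw [(Field.primitive_element_iff_minpoly_natDegree_eq ℚ α).mp hα, h2]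
  set m := minpoly ℚ α with hm
  set b : ℚ := m.coeff 1 with hb
  set c : ℚ := m.coeff 0 with hc
  have hm2 : m.coeff 2 = 1 := by
    have := (minpoly.monic (IsIntegral.of_finite ℚ α)).leadingCoeff
    rwa [Polynomial.leadingCoeff, ← hm, hdeg] at this
  -- α² + bα + c = 0 in K (rationals as casts: `algebraMap ℚ K r = r`)
  have hrel : α * α + (b : K) * α + (c : K) = 0 := by
    have h0 : aeval α m = 0 := minpoly.aeval ℚ α
    rw [aeval_eq_sum_range, hdeg] at h0
    simp only [Finset.sum_range_succ, Finset.sum_range_zero, zero_add, pow_zero, pow_one, hm2,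
      Algebra.smul_def, eq_ratCast] at h0
    rw [← hc, ← hb] at h0
    push_cast at h0
    linear_combination h0
  -- the discriminant b² − 4c is positive
  have hq_nonneg : 0 ≤ b ^ 2 - 4 * c := by
    have hrelR : σ α * σ α + (b : ℝ) * σ α + (c : ℝ) = 0 := by
      have := congrArg σ hrel
      simpa [map_add, map_mul, map_ratCast] using this
    have hsq : ((b : ℝ) ^ 2 - 4 * c) = (2 * σ α + b) ^ 2 := by linear_combination (-4 : ℝ) * hrelR
    have : (0 : ℝ) ≤ (b : ℝ) ^ 2 - 4 * c := by rw [hsq]; positivity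
    exact_mod_cast this
  have hq_ne : b ^ 2 - 4 * c ≠ 0 := by
    intro hq0
    -- then (α + b/2)² = 0, so α ∈ ℚ and the minimal polynomial is linear
    have hsq : (α + ((b / 2 : ℚ) : K)) ^ 2 = 0 := by
      have hc' : c = b ^ 2 / 4 := by linear_combination (-1 / 4 : ℚ) * hq0
      rw [hc'] at hrel
      push_cast at hrel ⊢
      linear_combination hrel
    have hαQ : α = algebraMap ℚ K (-(b / 2)) := by
      have h1 := (pow_eq_zero_iff (n := 2) (by norm_num)).mp hsq
      rw [eq_ratCast]
      push_cast at h1 ⊢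
      linear_combination h1
    have h1 : (minpoly ℚ α).natDegree = 1 := by rw [hαQ, minpoly.eq_X_sub_C]; exact natDegree_X_sub_C _
    rw [← hm, hdeg] at h1
    exact absurd h1 (by norm_num)
  have hq_pos : 0 < (b ^ 2 - 4 * c) / 4 := by positivity
  -- y := α + b/2 with y² = q, q := (b² − 4c)/4
  set q : ℚ := (b ^ 2 - 4 * c) / 4 with hq
  set y : K := α + ((b / 2 : ℚ) : K) with hy
  have hy2 : y * y = (q : K) := by
    rw [hy, hq]
    push_cast
    linear_combination hrel
  -- x := f y ∈ D, x² = q·1, x ∉ ℚ·1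
  set x : D := f y with hx
  have hx2 : x * x = algebraMap ℚ D q := by
    rw [hx, ← map_mul, hy2, ← eq_ratCast (algebraMap ℚ K), AlgHom.commutes]
  have hxQ : ∀ r : ℚ, x ≠ algebraMap ℚ D r := by
    intro r hxr
    have hyr : y = algebraMap ℚ K r := hfinj (by rw [← hx, hxr, AlgHom.commutes])
    have hαQ : α = algebraMap ℚ K (r - b / 2) := by
      rw [eq_ratCast] at hyr ⊢
      rw [hy] at hyr
      push_cast at hyr ⊢
      linear_combination hyr
    have h1 : (minpoly ℚ α).natDegree = 1 := by rw [hαQ, minpoly.eq_X_sub_C]; exact natDegree_X_sub_C _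
    rw [← hm, hdeg] at h1
    exact absurd h1 (by norm_num)
  -- the quadratic relation of x in D: x² = t'x − n' with Tr(L_x) = 2t'; necessarily t' = 0
  obtain ⟨t', n', hx2', htr⟩ := exists_mul_self_eq_of_isQuaternionAlgebra (K := ℚ) x
  have ht' : t' = 0 := by
    by_contra ht0
    have hlin : algebraMap ℚ D t' * x = algebraMap ℚ D (q + n') := by
      rw [map_add, ← hx2, hx2']; abel
    apply hxQ (t'⁻¹ * (q + n'))
    calc x = algebraMap ℚ D (t'⁻¹ * t') * x := by rw [inv_mul_cancel₀ ht0, map_one, one_mul]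
      _ = algebraMap ℚ D t'⁻¹ * (algebraMap ℚ D t' * x) := by rw [map_mul, mul_assoc]
      _ = algebraMap ℚ D (t'⁻¹ * (q + n')) := by rw [hlin, ← map_mul]
  rw [ht'] at hx2' htr
  have hx2'' : x * x = algebraMap ℚ D (0 : ℚ) * x - algebraMap ℚ D (-q) := by
    rw [map_zero, zero_mul, map_neg, zero_sub, neg_neg, hx2]
  obtain ⟨-, -, -, hnrd⟩ := IsQuaternionAlgebra.reducedTrace_reducedNorm_eq_of_mul_self_eq (K := ℚ) hx2'' htr
  have hnn := reducedNorm_nonneg_of_isTotallyDefinite D hdef x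
  rw [hnrd] at hnn
  linarith

/-- Hence: `[K:ℚ] = 2` and `K ↪ D` totally definite ⇒ `K` is imaginary quadratic (tree `IsImaginaryQuadratic`). [cite: VignerasLNM800, Ch. III §3] -/
theorem isImaginaryQuadratic_of_algHom [IsQuaternionAlgebra ℚ D] (hdef : IsTotallyDefinite ℚ D) (f : K →ₐ[ℚ] D)
    (h2 : finrank ℚ K = 2) : IsImaginaryQuadratic K :=
  ⟨h2, isTotallyComplex_of_algHom hdef f h2⟩

/-! ### §3 Towers of Gross points force `[K:ℚ] = 1` or `K` imaginary quadratic -/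

/-- **A tower of Gross points on a Brandt setup over `K` exists only if `[K:ℚ] = 1` or `K` is imaginary quadratic**: the point `x_0` is
the class of a pair `(f, I)` with `f : K →ₐ[ℚ] D`, `D` the totally definite quaternion algebra of the setup (§1, §2). So the number fields
in the registered `stub_towerSqrt` beyond the imaginary quadratic ones are vacuous except `K ≅ ℚ`. [cite: BertoliniDarmon1996, §2.1] -/
theorem finrank_eq_one_or_isImaginaryQuadratic_of_grossPointTower {Nplus Nminus : ℕ} (S : Brandt.XiSetup Nplus Nminus) {p : ℕ}
    (T : GrossPointTower K S p) : finrank ℚ K = 1 ∨ IsImaginaryQuadratic K := by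
  obtain ⟨r, -⟩ := GrossSpace.mk_surjective (T.pt 0)
  have hle := finrank_le_two_of_algHom (D := S.D) r.emb
  have hpos : 0 < finrank ℚ K := finrank_pos
  rcases Nat.lt_or_ge (finrank ℚ K) 2 with hlt | hge
  · left; omega
  · right
    exact isImaginaryQuadratic_of_algHom S.isTotallyDefinite r.emb (le_antisymm hle hge)

end Summit.BirchSwinnertonDyer.BirchSwinnertonDyer.Theorems.TowerSqrt

end
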